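import Summits.BirchSwinnertonDyer.BirchSwinnertonDyer.Theorems.ManinLocalTwoThreeNegOneTwistConductorAtTwo
import HarnessLib

/-!
# S-an-64, local half: the totally-blind `u`-family `y² = (x + u)(x² + 4)` has Kodaira type IV* and `f₂ = 2` at `2`
# for `u ≡ 1 (mod 4)` — Tate's algorithm over `ℤ₂` on the explicit family (route `ManinLocalTwoThree`, crux C2 `ManinOddAtFour`
# stmt-BirchSwinnertonDyer-22967; cell bsd-f2-manin, an g32 MEMO-an §75.11 row S-an-64 `UFamilyConductorLaw`; p3 gen 12)

an g32 (§75.11, CANDIDATES row S-an-64) reduced the ODD-`u` half of the totally-blind residual E-an-50R `UFamilyManinOdd`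
(the family `E_u : y² = (x + u)(x² + 4)`, i.e. the model `[0, 3s + u, 0, 3s² + 2su + 4, (s + u)(s² + 4)]` up to translation)
to modularity + ČNS + two census laws, one of which is the CONDUCTOR law S-an-64: `u ≡ 1 (mod 4) ⟹ 4 ∥ N`,
`u ≡ 3 (mod 4) ⟹ N(W) = 4 · N(W ⊗ χ₋₄)`.  This file proves the local content by Tate's algorithm over `ℤ₂`:

* §1 `uFamily_exitModel_IVstar`: for `k ∈ ℤ₂`, `(1, 0, 1, 2) • [0, 4k+1, 0, 4, 4(4k+1)] = [2, 4k, 4, 0, 16k]` is a Step-8 exit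
  (`2 ∣ a₁`, `4 ∣ a₂, a₃`, `8 ∣ a₄`, `16 ∣ a₆`, quadratic `Y² + Y − k` separable in characteristic `2`): type **IV***;
  `addVal_Δ_uFamily_exitModel`: `Δ = −2⁸((4k+1)² + 4)²` has `ord₂ = 8` (`(4k+1)² + 4 = 1 + 2(8k² + 4k + 2)` is a unit).
* §2 `conductorExponent_two_of_exitModel`: Ogg's formula read on an explicit exit model over `ℤ₂` (the generic form of the sibling
  `conductorExponent_negTwist_of_exitModel` of `…NegOneTwistConductorAtTwo`, p2 gen 13).
* §3 `conductorExponent_two_eq_two_of_eq_uFamilyModel` (`f₂(E_u) = 8 + 1 − 7 = 2` for `u ≡ 1 (mod 4)`) and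
  `padicValNat_two_conductorNorm_of_uFamily`: **`v₂(N(W)) = 2`** for every elliptic `W/ℚ` satisfying an's `IsUFamilyCurve W u`
  (body VERBATIM as the hypothesis; the typer's leaf is not yet in the tree) with `u ≡ 1 (mod 4)` — undo the translation by
  `(1, −s, 0, 0)`, `f₂` is an isomorphism invariant (`conductorExponent_smul'`), `N = ∏ p^{f_p}` (`factorization_conductorNorm`).
* §4 `uFamily_quadraticTwist_negOne`: the `χ₋₄`-twist of the model `(u, s)` is the model `(−u, −s)` (an g32 §12, restated on the body).

The sibling `…UFamilyConductorLaw.lean` assembles S-an-64 itself (the `u ≡ 3 (mod 4)` clause via p2's S-an-58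
`conductorNorm_quadraticTwist_negOne_eq_four_mul` applied to the twist).  Census (an g32 blind_census.out 86a231102f868176): all 55
totally-blind optimal classes with `4 ∥ N ≤ 5·10⁵` are IV* members `u ≡ 1 (4)`; all 31 with `16 ∣ N` are I₀* members `u ≡ 3 (4)`.

HONEST FRAMING: an elementary local computation (in print as the IV* → I₀* row of Barrios et al. 2025 Thm. 5.1 once the type is
known; the type of the explicit family is the new bookkeeping).  Nothing about BSD or Manin's conjecture is proved; C2 OPEN.
[cite: SilvermanATAEC1994, IV.9.4 Steps 1–8 and IV.11.1 (PDF pp. 344–346, 361)] [cite: BarriosEtAl2025, Thm. 5.1 (arXiv:2501.03209 pp. 15–16)]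
[cite: SilvermanAEC2009, C.16 (the conductor as ∏ p^{f_p})]
-/

set_option autoImplicit false
-- lint-debt: the directory name repeats the summit name (sibling precedent `ManinLocalTwoThreeNegOneTwistConductorAtTwo.lean`)
set_option linter.dupNamespace false

noncomputable section

open scoped Classical
open Polynomial IsLocalRing WeierstrassCurve
open IsDiscreteValuationRing hiding maximalIdeal
open Literature.NumberTheory.DiophantineGeometry Literature.NumberTheory.DiophantineGeometry.TateAlgorithm

namespace Summit.BirchSwinnertonDyer.BirchSwinnertonDyer.Theorems.ManinLocalTwoThree

/-! ## §1 The local exit: `y² = x³ + u x² + 4 x + 4u`, `u = 4k + 1`, is of type IV* at `2` -/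

/-- **The `u`-family exit model is of type IV*.**  For `k ∈ ℤ₂`, Tate's algorithm returns `IV*` on
`T′ = (1, 0, 1, 2) • [0, 4k + 1, 0, 4, 4(4k + 1)] = [2, 4k, 4, 0, 16k]` (Step 8: `2 ∣ a₁`, `4 ∣ a₂, a₃`, `8 ∣ a₄`, `16 ∣ a₆`, so the
Step-6 cubic is `T³`; the quadratic `Y² + ε̄²Y − ε̄⁴k̄` has discriminant `ε̄⁴ ≠ 0` over `𝔽₂`, `2 = ϖε`).
[cite: SilvermanATAEC1994, IV.9.4 Steps 6–8 (PDF pp. 344–346)] -/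
theorem uFamily_exitModel_IVstar (k : ℤ_[2]) :
    ((⟨1, 0, 1, 2⟩ : VariableChange ℤ_[2]) •
        (⟨0, 4 * k + 1, 0, 4, 4 * (4 * k + 1)⟩ : WeierstrassCurve ℤ_[2])).kodairaSymbolOfMinimal = .IVstar := by
  obtain ⟨ε, hε, hpε⟩ := Literature.NumberTheory.EllipticCurves.TwistGoodTwo.exists_isUnit_two_eq_uniformizer_mul_padicInt
  set ϖ : ℤ_[2] := uniformizer ℤ_[2] with hϖ
  set T' : WeierstrassCurve ℤ_[2] := (⟨1, 0, 1, 2⟩ : VariableChange ℤ_[2]) •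
    (⟨0, 4 * k + 1, 0, 4, 4 * (4 * k + 1)⟩ : WeierstrassCurve ℤ_[2]) with hT'
  have e1 : T'.a₁ = ϖ * ε := by
    rw [hT', variableChange_a₁]; simp; linear_combination hpε
  have e2 : T'.a₂ = ϖ ^ 2 * (ε ^ 2 * k) := by
    rw [hT', variableChange_a₂]; simp; linear_combination k * (ϖ * ε + 2) * hpε
  have e3 : T'.a₃ = ϖ ^ 2 * ε ^ 2 := by
    rw [hT', variableChange_a₃]; simp; linear_combination (ϖ * ε + 2) * hpε
  have e4 : T'.a₄ = ϖ ^ 3 * 0 := by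
    rw [hT', variableChange_a₄]; simp; ring
  have e6 : T'.a₆ = ϖ ^ 4 * (ε ^ 4 * k) := by
    rw [hT', variableChange_a₆]; simp
    linear_combination k * (ϖ ^ 3 * ε ^ 3 + 2 * ϖ ^ 2 * ε ^ 2 + 4 * ϖ * ε + 8) * hpε
  refine kodairaSymbolOfMinimal_eq_IVstar_of_step8 ?_ ?_ ?_ ?_ ?_ ?_
  · rw [e1]; exact dvd_mul_right _ _
  · rw [e2]; exact dvd_mul_right _ _
  · rw [e3]; exact dvd_mul_right _ _
  · rw [e4]; exact dvd_mul_right _ _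
  · rw [e6]; exact dvd_mul_right _ _
  · rw [quadraticStep8, e3, e6, redCoeff_uniformizer_pow_mul, redCoeff_uniformizer_pow_mul,
      distinctRootCount_sq_add_sub_eq_two_iff]
    have h4 : (4 : IsLocalRing.ResidueField ℤ_[2]) = 0 := by
      rw [show (4 : IsLocalRing.ResidueField ℤ_[2]) = 2 * 2 by norm_num, two_eq_zero_residueField_padicInt, mul_zero]
    rw [h4, zero_mul, add_zero, ← map_pow]
    exact (IsLocalRing.residue_ne_zero_iff_isUnit _).mpr ((hε.pow 2).pow 2)


/-- `ord₂ Δ = 8` on the exit model: `Δ([0, U, 0, 4, 4U]) = −2⁸ (U² + 4)²` and `U² + 4 = 1 + 2(8k² + 4k + 2)` is a unit for `U = 4k + 1`. -/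
theorem addVal_Δ_uFamily_exitModel (k : ℤ_[2]) :
    (addVal ℤ_[2] ((⟨1, 0, 1, 2⟩ : VariableChange ℤ_[2]) •
        (⟨0, 4 * k + 1, 0, 4, 4 * (4 * k + 1)⟩ : WeierstrassCurve ℤ_[2])).Δ).toNat = 8 := by
  have hirr : Irreducible (2 : ℤ_[2]) := by exact_mod_cast PadicInt.irreducible_p (p := 2)
  rw [addVal_Δ_smul_toNat]
  have hu : IsUnit ((4 * k + 1) ^ 2 + 4 : ℤ_[2]) := by
    rw [show ((4 * k + 1) ^ 2 + 4 : ℤ_[2]) = 1 + 2 * (8 * k ^ 2 + 4 * k + 2) by ring]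
    exact isUnit_one_add_two_mul_padicInt _
  refine addVal_toNat_eq_of_eq hirr (c := 1) (u := -(((4 * k + 1) ^ 2 + 4) ^ 2)) (n := 8) isUnit_one (hu.pow 2).neg ?_
  simp only [WeierstrassCurve.Δ, WeierstrassCurve.b₂, WeierstrassCurve.b₄, WeierstrassCurve.b₆, WeierstrassCurve.b₈]
  ring

/-! ## §2 Ogg's formula read on an explicit exit model over `ℤ₂` -/

/-- **Ogg's formula read on an explicit exit model over `ℤ₂`.**  If `Cfin • (W ⊗ ℚ₂) = T′ ⊗ ℚ₂` for a `ℤ₂`-model `T′` on which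
Tate's algorithm exits (not `I₀`), then `T′` is minimal and `f₂(W) = ord₂ Δ(T′) + 1 − m(T′)`.  (The sibling
`conductorExponent_negTwist_of_exitModel` of `…NegOneTwistConductorAtTwo` is the same statement for `W ⊗ (−1)`; the proof is generic.)
[cite: SilvermanATAEC1994, IV.9.4 and IV.11.1] -/
theorem conductorExponent_two_of_exitModel (W : WeierstrassCurve ℚ) [W.IsElliptic]
    (T' : WeierstrassCurve ℤ_[2]) (Cfin : VariableChange ℚ_[2])
    (h : T'.map (algebraMap ℤ_[2] ℚ_[2]) = Cfin • W.baseChange ℚ_[2])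
    (hne : T'.kodairaSymbolOfMinimal ≠ .I 0) :
    W.conductorExponent ((Rat.HeightOneSpectrum.primesEquiv (R := ℤ)).symm ⟨2, Nat.prime_two⟩) =
      (addVal ℤ_[2] T'.Δ).toNat + 1 - T'.kodairaSymbolOfMinimal.numComponents := by
  haveI : Fact (Nat.Prime 2) := ⟨Nat.prime_two⟩
  haveI : Finite (ResidueField ℤ_[2]) := Finite.of_equiv _ (PadicInt.residueField (p := 2)).toEquiv.symm
  set v : IsDedekindDomain.HeightOneSpectrum ℤ := (Rat.HeightOneSpectrum.primesEquiv (R := ℤ)).symm ⟨2, Nat.prime_two⟩ with hvdef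
  have e : Rat.HeightOneSpectrum.primesEquiv (R := ℤ) v = ⟨2, Nat.prime_two⟩ := Equiv.apply_symm_apply _ _
  set X : WeierstrassCurve ℚ_[2] := W.baseChange ℚ_[2] with hX
  haveI hmin : (T'.baseChange ℚ_[2]).IsMinimal ℤ_[2] :=
    isMinimal_baseChange_of_kodairaSymbolOfMinimal_ne_I_zero (K := ℚ_[2]) T' hne
  have hTb : T'.baseChange ℚ_[2] = Cfin • X := h
  have hΔ : (T'.baseChange ℚ_[2]).Δ ≠ 0 := by
    rw [hTb]; exact (Cfin • X).isUnit_Δ.ne_zero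
  have hkod : X.kodairaSymbol ℤ_[2] = T'.kodairaSymbolOfMinimal := by
    rw [kodairaSymbol_eq_kodairaSymbolOfMinimal_of_isMinimal (R := ℤ_[2]) X (T'.baseChange ℚ_[2]) Cfin hTb hΔ,
      WeierstrassCurve.integralModel_baseChange_eq]
  have hord : (addVal ℤ_[2] ((X.minimal ℤ_[2]).integralModel ℤ_[2]).Δ).toNat = (addVal ℤ_[2] T'.Δ).toNat := by
    rw [addVal_Δ_minimal_toNat_eq_of_isMinimal (R := ℤ_[2]) X (T'.baseChange ℚ_[2]) Cfin hTb hΔ,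
      WeierstrassCurve.integralModel_baseChange_eq]
  have hf := WeierstrassCurve.conductorExponent_eq_padic (R := ℤ) v W
  rw [e] at hf
  change W.conductorExponent v =
    (addVal ℤ_[2] ((X.minimal ℤ_[2]).integralModel ℤ_[2]).Δ).toNat + 1 - (X.kodairaSymbol ℤ_[2]).numComponents at hf
  rw [hf, hord, hkod]

/-! ## §3 The curve `E_u : y² = x³ + u x² + 4 x + 4u` (`u ≡ 1 mod 4`) has `f₂ = 2` -/

/-- **`f₂(E_u) = 2` for `u ≡ 1 (mod 4)`**, `E_u = [0, u, 0, 4, 4u]`: over `ℤ₂`, `(1, 0, 1, 2) • E_u = [2, u − 1, 4, 0, 4(u − 1)]` is a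
Step-8 exit of Tate's algorithm (type IV*, `m = 7`), minimal with `ord₂ Δ = 8`, so Ogg's formula gives `f₂ = 8 + 1 − 7 = 2`.
Stated for any `ℚ`-model `V` equal to `E_u` (so that no separate `IsElliptic` instance is needed).
[cite: SilvermanATAEC1994, IV.9.4 Steps 6–8 and IV.11.1] -/
theorem conductorExponent_two_eq_two_of_eq_uFamilyModel (V : WeierstrassCurve ℚ) [V.IsElliptic] (u : ℤ) (hu : u % 4 = 1)
    (hV : V = ⟨0, (u : ℚ), 0, 4, 4 * (u : ℚ)⟩) :
    V.conductorExponent ((Rat.HeightOneSpectrum.primesEquiv (R := ℤ)).symm ⟨2, Nat.prime_two⟩) = 2 := by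
  haveI : Fact (Nat.Prime 2) := ⟨Nat.prime_two⟩
  -- `u = 4k + 1`
  set k : ℤ := u / 4 with hk
  have huk : u = 4 * k + 1 := by omega
  -- the `ℤ₂`-model and its exit model
  set E : WeierstrassCurve ℤ_[2] := ⟨0, 4 * (k : ℤ_[2]) + 1, 0, 4, 4 * (4 * (k : ℤ_[2]) + 1)⟩ with hE
  set T' : WeierstrassCurve ℤ_[2] := (⟨1, 0, 1, 2⟩ : VariableChange ℤ_[2]) • E with hT'
  have hEV : E.map (algebraMap ℤ_[2] ℚ_[2]) = V.baseChange ℚ_[2] := by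
    have c4 : ((4 : ℤ_[2]) : ℚ_[2]) = 4 := map_ofNat PadicInt.Coe.ringHom 4
    rw [hV, hE, huk]
    ext <;> simp [WeierstrassCurve.map, c4]
  have h : T'.map (algebraMap ℤ_[2] ℚ_[2]) =
      ((⟨1, 0, 1, 2⟩ : VariableChange ℤ_[2]).map (algebraMap ℤ_[2] ℚ_[2])) • V.baseChange ℚ_[2] := by
    rw [hT', ← hEV]
    exact (WeierstrassCurve.map_variableChange _ _ _).symm
  have hexit : T'.kodairaSymbolOfMinimal = .IVstar := uFamily_exitModel_IVstar (k : ℤ_[2])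
  rw [conductorExponent_two_of_exitModel V T' _ h (by rw [hexit]; decide), hexit, hT', hE,
    addVal_Δ_uFamily_exitModel]
  rfl

/-- **`v₂(N(W)) = 2` on the `u`-family, `u ≡ 1 (mod 4)`.**  If some `ℚ`-isomorph `C • W` of `W` is the translated model
`[0, 3s + u, 0, 3s² + 2su + 4, (s + u)(s² + 4)]` of `y² = (x + u)(x² + 4)` (an's `IsUFamilyCurve W u`, body verbatim), then
`(1, −s, 0, 0) • C • W = E_u = [0, u, 0, 4, 4u]`, `f₂` is an isomorphism invariant, and `f₂(E_u) = 2`.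
[cite: SilvermanATAEC1994, IV.9.4 and IV.11.1] [cite: SilvermanAEC2009, C.16] -/
theorem padicValNat_two_conductorNorm_of_uFamily (W : WeierstrassCurve ℚ) [W.IsElliptic] (u : ℤ) (hu : u % 4 = 1)
    (hW : ∃ (C : VariableChange ℚ) (s : ℤ), (C • W).a₁ = 0 ∧ (C • W).a₃ = 0 ∧ (C • W).a₂ = (3 * s + u : ℤ) ∧
      (C • W).a₄ = (3 * s ^ 2 + 2 * s * u + 4 : ℤ) ∧ (C • W).a₆ = ((s + u) * (s ^ 2 + 4) : ℤ)) :
    padicValNat 2 (W.conductorNorm ℤ) = 2 := by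
  haveI : Fact (Nat.Prime 2) := ⟨Nat.prime_two⟩
  obtain ⟨C, s, h₁, h₃, h₂, h₄, h₆⟩ := hW
  set v : IsDedekindDomain.HeightOneSpectrum ℤ := (Rat.HeightOneSpectrum.primesEquiv (R := ℤ)).symm ⟨2, Nat.prime_two⟩
    with hvdef
  have hv : Rat.HeightOneSpectrum.natGenerator v = 2 :=
    congrArg Subtype.val ((Rat.HeightOneSpectrum.primesEquiv (R := ℤ)).apply_symm_apply ⟨2, Nat.prime_two⟩)
  -- undo the translation: `(1, −s, 0, 0) • (C • W) = E_u`
  set C' : VariableChange ℚ := (⟨1, -(s : ℚ), 0, 0⟩ : VariableChange ℚ) * C with hC'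
  have hV : C' • W = ⟨0, (u : ℚ), 0, 4, 4 * (u : ℚ)⟩ := by
    rw [hC', mul_smul]
    ext
    · rw [variableChange_a₁, h₁]; simp
    · rw [variableChange_a₂, h₁, h₂]; push_cast; simp
    · rw [variableChange_a₃, h₁, h₃]; simp
    · rw [variableChange_a₄, h₁, h₂, h₃, h₄]; push_cast; simp; ring
    · rw [variableChange_a₆, h₁, h₂, h₃, h₄, h₆]; push_cast; simp; ring
  have hf : W.conductorExponent v = 2 := by
    rw [← WeierstrassCurve.conductorExponent_smul' v W C']
    exact conductorExponent_two_eq_two_of_eq_uFamilyModel (C' • W) u hu hV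
  have hfac : (W.conductorNorm ℤ).factorization 2 = W.conductorExponent v := by
    rw [← hv]; exact W.factorization_conductorNorm_holds v
  rw [← Nat.factorization_def _ Nat.prime_two, hfac, hf]

/-! ## §4 The `χ₋₄`-twist stays in the family: `u ↦ −u` -/

/-- The `χ₋₄`-twist of the `u`-family model `(u, s)` is the `u`-family model `(−u, −s)`:
`−[(−x + s + u)((−x + s)² + 4)] = (x − s − u)((x − s)² + 4)` (an g32 §12 `isUFamilyCurve_quadraticTwist_negOne`, restated on the
body so that this file does not wait for the typer's leaf). [cite: SilvermanAEC2009, X.2 Prop. 2.4 (shape of the quadratic twist)] -/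
theorem uFamily_quadraticTwist_negOne {W : WeierstrassCurve ℚ} {u : ℤ}
    (hW : ∃ (C : VariableChange ℚ) (s : ℤ), (C • W).a₁ = 0 ∧ (C • W).a₃ = 0 ∧ (C • W).a₂ = (3 * s + u : ℤ) ∧
      (C • W).a₄ = (3 * s ^ 2 + 2 * s * u + 4 : ℤ) ∧ (C • W).a₆ = ((s + u) * (s ^ 2 + 4) : ℤ)) :
    ∃ (C : VariableChange ℚ) (s : ℤ), (C • W.quadraticTwist ((-1 : ℤ) : ℚ)).a₁ = 0 ∧
      (C • W.quadraticTwist ((-1 : ℤ) : ℚ)).a₃ = 0 ∧ (C • W.quadraticTwist ((-1 : ℤ) : ℚ)).a₂ = (3 * s + (-u) : ℤ) ∧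
      (C • W.quadraticTwist ((-1 : ℤ) : ℚ)).a₄ = (3 * s ^ 2 + 2 * s * (-u) + 4 : ℤ) ∧
      (C • W.quadraticTwist ((-1 : ℤ) : ℚ)).a₆ = ((s + (-u)) * (s ^ 2 + 4) : ℤ) := by
  obtain ⟨C, s, h₁, h₃, h₂, h₄, h₆⟩ := hW
  have key := WeierstrassCurve.quadraticTwist_smul (W := W) C ((-1 : ℤ) : ℚ)
  refine ⟨⟨C.u, ((-1 : ℤ) : ℚ) * C.r, 0, 0⟩, -s, ?_⟩
  rw [← key]
  refine ⟨rfl, rfl, ?_, ?_, ?_⟩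
  · rw [quadraticTwist_a₂, WeierstrassCurve.b₂, h₁, h₂]; push_cast; ring
  · rw [quadraticTwist_a₄, WeierstrassCurve.b₄, h₁, h₃, h₄]; push_cast; ring
  · rw [quadraticTwist_a₆, WeierstrassCurve.b₆, h₃, h₆]; push_cast; ring

end Summit.BirchSwinnertonDyer.BirchSwinnertonDyer.Theorems.ManinLocalTwoThree

end
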